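import Mathlib
import Summits.ABC.ABC.Statement
import Literature.NumberTheory.DiophantineGeometry.AbcImpliesHall
import Summits.ABC.ABC.Theorems.SoloInformedRNShape

/-!
# Squares versus powers of a fixed base: `abc` ⟹ `|x² − qⁿ| ≫ q^{n/6 − 1}` for both signs,
# uniformly in `q` — the "largest solution" of the generalised Ramanujan–Nagell equation (solo-ABC-informed, s15)

`SoloInformedRNShape` gave, from `ABC` at `ε = 1/2`, the RN-shape `qⁿ < K·D⁶·q⁶` on `x² + D = qⁿ`.
Here the real-quadratic sign `x² − D = qⁿ` is treated the same way (`soloInformed_rnShapeMinus_of_abc`,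
triple `(D, qⁿ, x²)`), and the two are combined into the base-uniform, sign-free statement
`soloInformed_squares_vs_powers_of_abc`: one `K` with `qⁿ < K · |x² − qⁿ|⁶ · q⁶` for all `q ≥ 1`, `n`,
and `x` coprime to `q` with `x² ≠ qⁿ` — an (ineffective-constant) restricted-denominator improvement of
Liouville for `√q` along the denominators `q^k`, of the kind Ridout's theorem gives ineffectively.

Context (why this is the statement to record). F. Beukers, *On the generalized Ramanujan–Nagell
equation II*, Acta Arith. 39 (1981) 113–123, Theorem 1 (p. 117): for `D > 0` not a square and an odd
prime `p ∤ D`, if `x² − D = pⁿ` has two solutions `(A,k)`, `(A',k')` with `k' > k` then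
`p^k ≤ max(2·10⁶, 600·D²)` — abc-shape with exponent 2, uniformly in `p`, for every solution EXCEPT the
largest (p-adic Padé approximation anchored at the smaller solution). The largest solution — and any pair `(x, n)` with
`pⁿ > max(2·10⁶, 600·D²)`, `D = |x² − pⁿ|`, is the largest solution for its `D` by that theorem — is bounded by no effective method at a
base without a Beukers anchor (e.g. `5, 7, 11`); `ABC` bounds it for all bases at once, as below.
[cite: Beukers1981II, Acta Arith. 39, Thm 1 p.117, Thm 2 p.122]
-/

namespace Summit.ABC.ABC.Theorems

open Literature.NumberTheory.DiophantineGeometry UniqueFactorizationMonoid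

/-- The radical of the real-quadratic Ramanujan–Nagell triple: `rad(D · qⁿ · x²) ≤ D · q · x`. [folklore] -/
theorem soloInformed_rad_rnMinus_le {D x q n : ℕ} (hx : 0 < x) (hq : 0 < q) (hD : 0 < D) :
    rad D (q ^ n) (x ^ 2) ≤ D * q * x := by
  rw [rad_def]
  calc radical (D * q ^ n * x ^ 2) ≤ radical D * radical (q ^ n) * radical (x ^ 2) :=
        radical_mul_three_le _ _ _
    _ ≤ D * q * x := by
        gcongr
        · exact Nat.radical_le_self_iff.mpr hD.ne'
        · exact radical_le_of_dvd_pow hq.ne' (dvd_refl _)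
        · exact radical_le_of_dvd_pow hx.ne' (dvd_refl _)

/-- `(D, qⁿ, x²)` with `D + qⁿ = x²`, `D, q > 0`, `gcd(D, x) = 1` is an abc triple. [folklore] -/
theorem soloInformed_isABCTriple_rnMinus {D x q n : ℕ} (hq : 0 < q) (hD : 0 < D)
    (hcop : Nat.Coprime D x) (h : D + q ^ n = x ^ 2) : IsABCTriple D (q ^ n) (x ^ 2) := by
  refine ⟨hD, pow_pos hq n, h, ?_⟩
  have h2 : Nat.Coprime D (x ^ 2) := Nat.Coprime.pow_right 2 hcop
  rw [← h] at h2
  exact Nat.coprime_self_add_right.mp h2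

/-- **RN-shape from abc, real-quadratic sign, uniformly in the base.** `ABC` (at `ε = 1/2`) gives one
`K` with `qⁿ < K · D⁶ · q⁶` whenever `x² − D = qⁿ` (`q, D ≥ 1`, `gcd(D, x) = 1`). [folklore] -/
theorem soloInformed_rnShapeMinus_of_abc (habc : _root_.ABC) :
    ∃ K : ℝ, 0 < K ∧ ∀ q x D n : ℕ, 0 < q → 0 < D → Nat.Coprime D x →
      D + q ^ n = x ^ 2 → ((q : ℝ) ^ n) < K * (D : ℝ) ^ 6 * (q : ℝ) ^ 6 := by
  obtain ⟨C, hC, hC'⟩ := (_root_.ABC_iff.mp habc) (1 / 2) (by norm_num)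
  refine ⟨C ^ 4, by positivity, fun q x D n hq hD hcop h => ?_⟩
  have hx : 0 < x := by
    rcases Nat.eq_zero_or_pos x with h0 | h0
    · subst h0; simp at h; omega
    · exact h0
  have ht := soloInformed_isABCTriple_rnMinus hq hD hcop h
  have hlt := hC' D (q ^ n) (x ^ 2) ht
  set c : ℝ := ((x ^ 2 : ℕ) : ℝ) with hc_def
  set r : ℝ := ((rad D (q ^ n) (x ^ 2) : ℕ) : ℝ) with hr_def
  have hc0 : 0 < c := by rw [hc_def]; exact_mod_cast pow_pos hx 2
  have hr0 : 0 ≤ r := by rw [hr_def]; exact_mod_cast Nat.zero_le _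
  have h32 : (1 : ℝ) + 1 / 2 = 3 / 2 := by norm_num
  rw [h32] at hlt
  have h4 : c ^ 4 < (C * r ^ ((3 : ℝ) / 2)) ^ 4 := pow_lt_pow_left₀ hlt hc0.le (by norm_num)
  have hr6 : (r ^ ((3 : ℝ) / 2)) ^ 4 = r ^ 6 := by
    rw [← Real.rpow_mul_natCast hr0]
    norm_num
  rw [mul_pow, hr6] at h4
  have hrle : rad D (q ^ n) (x ^ 2) ≤ D * q * x := soloInformed_rad_rnMinus_le hx hq hD
  have hnat : (rad D (q ^ n) (x ^ 2)) ^ 6 ≤ D ^ 6 * q ^ 6 * (x ^ 2) ^ 3 := by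
    calc (rad D (q ^ n) (x ^ 2)) ^ 6 ≤ (D * q * x) ^ 6 := Nat.pow_le_pow_left hrle 6
      _ = D ^ 6 * q ^ 6 * (x ^ 2) ^ 3 := by ring
  have hreal : r ^ 6 ≤ (D : ℝ) ^ 6 * (q : ℝ) ^ 6 * c ^ 3 := by
    rw [hr_def, hc_def]; exact_mod_cast hnat
  have h5 : c ^ 4 < C ^ 4 * ((D : ℝ) ^ 6 * (q : ℝ) ^ 6 * c ^ 3) := by
    calc c ^ 4 < C ^ 4 * r ^ 6 := h4
      _ ≤ C ^ 4 * ((D : ℝ) ^ 6 * (q : ℝ) ^ 6 * c ^ 3) := by gcongr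
  have hc3 : 0 < c ^ 3 := by positivity
  have h6 : c * c ^ 3 < (C ^ 4 * (D : ℝ) ^ 6 * (q : ℝ) ^ 6) * c ^ 3 := by
    calc c * c ^ 3 = c ^ 4 := by ring
      _ < C ^ 4 * ((D : ℝ) ^ 6 * (q : ℝ) ^ 6 * c ^ 3) := h5
      _ = (C ^ 4 * (D : ℝ) ^ 6 * (q : ℝ) ^ 6) * c ^ 3 := by ring
  have h7 : c < C ^ 4 * (D : ℝ) ^ 6 * (q : ℝ) ^ 6 := lt_of_mul_lt_mul_right h6 hc3.le
  -- qⁿ < x² = c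
  have hqn : q ^ n < x ^ 2 := by omega
  have hqc : ((q : ℝ) ^ n) < c := by rw [hc_def]; exact_mod_cast hqn
  exact lt_trans hqc h7

/-- **Squares versus powers of a fixed base, from abc (both signs, uniform in the base).**
`ABC` gives one `K` with `qⁿ < K · |x² − qⁿ|⁶ · q⁶` for all `q ≥ 1`, all `n`, and all `x` coprime to `q`
with `x² ≠ qⁿ`: squares keep the distance `≫ q^{n/6 − 1}` from `qⁿ` on both sides. This is the statement about
the LARGEST solution of `x² ± D = qⁿ` that no effective method reaches at an unanchored base
(Beukers II, Thm 1, bounds all other solutions by `600·D²`, uniformly in odd `p`). [folklore] -/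
theorem soloInformed_squares_vs_powers_of_abc (habc : _root_.ABC) :
    ∃ K : ℝ, 0 < K ∧ ∀ q n x : ℕ, 0 < q → Nat.Coprime q x → x ^ 2 ≠ q ^ n →
      ((q : ℝ) ^ n) < K * ((((x : ℤ) ^ 2 - (q : ℤ) ^ n).natAbs : ℕ) : ℝ) ^ 6 * (q : ℝ) ^ 6 := by
  obtain ⟨K₁, hK₁, hK₁'⟩ := soloInformed_rnShape_of_abc habc
  obtain ⟨K₂, hK₂, hK₂'⟩ := soloInformed_rnShapeMinus_of_abc habc
  refine ⟨K₁ + K₂ + 2, by positivity, fun q n x hq hqx hne => ?_⟩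
  have hq0 : (0 : ℝ) < q := by exact_mod_cast hq
  have hcop2 : Nat.Coprime (q ^ n) (x ^ 2) := Nat.Coprime.pow n 2 hqx
  rcases lt_or_gt_of_ne hne with hlt | hgt
  · -- x² < qⁿ : plus sign, D = qⁿ − x²
    set D : ℕ := q ^ n - x ^ 2 with hD_def
    have hD : 0 < D := by omega
    have hsum : x ^ 2 + D = q ^ n := by omega
    have habsD : (((x : ℤ) ^ 2 - (q : ℤ) ^ n).natAbs : ℕ) = D := by
      have e : ((x : ℤ) ^ 2 - (q : ℤ) ^ n) = -(D : ℤ) := by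
        rw [hD_def]; push_cast [Nat.cast_sub hlt.le]; ring
      rw [e, Int.natAbs_neg]; simp
    rw [habsD]
    rcases Nat.eq_zero_or_pos x with hx0 | hx0
    · -- x = 0 forces q = 1
      subst hx0
      have hq1 : q = 1 := by simpa using hqx
      subst hq1
      have hD1 : D = 1 := by rw [hD_def]; simp
      rw [hD1]; norm_num; linarith
    · have hcopD : Nat.Coprime D x := by
        have h1 : Nat.Coprime (q ^ n - x ^ 2) (x ^ 2) := (Nat.coprime_sub_self_left hlt.le).mpr hcop2
        exact Nat.Coprime.coprime_dvd_right ⟨x, by ring⟩ h1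
      have hb := hK₁' q x D n hq hx0 hD hcopD hsum
      have hD0 : (0 : ℝ) < D := by exact_mod_cast hD
      calc ((q : ℝ) ^ n) < K₁ * (D : ℝ) ^ 6 * (q : ℝ) ^ 6 := hb
        _ ≤ (K₁ + K₂ + 2) * (D : ℝ) ^ 6 * (q : ℝ) ^ 6 := by gcongr; linarith
  · -- qⁿ < x² : minus sign, D = x² − qⁿ
    set D : ℕ := x ^ 2 - q ^ n with hD_def
    have hD : 0 < D := by omega
    have hsum : D + q ^ n = x ^ 2 := by omega
    have habsD : (((x : ℤ) ^ 2 - (q : ℤ) ^ n).natAbs : ℕ) = D := by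
      have e : ((x : ℤ) ^ 2 - (q : ℤ) ^ n) = (D : ℤ) := by
        rw [hD_def]; push_cast [Nat.cast_sub hgt.le]; ring
      rw [e]; simp
    rw [habsD]
    have hcopD : Nat.Coprime D x := by
      have h1 : Nat.Coprime (x ^ 2 - q ^ n) (x ^ 2) := (Nat.coprime_self_sub_left hgt.le).mpr hcop2
      exact Nat.Coprime.coprime_dvd_right ⟨x, by ring⟩ h1
    have hb := hK₂' q x D n hq hD hcopD hsum
    have hD0 : (0 : ℝ) < D := by exact_mod_cast hD
    calc ((q : ℝ) ^ n) < K₂ * (D : ℝ) ^ 6 * (q : ℝ) ^ 6 := hb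
      _ ≤ (K₁ + K₂ + 2) * (D : ℝ) ^ 6 * (q : ℝ) ^ 6 := by gcongr; linarith

/-- Beukers II, Theorem 1, as exact arithmetic on its extremal exceptional family (p. 119): for
`p = 4a² + ε`, `D = ((p^l − ε)/4a)² − p^l` the equation `x² − D = pⁿ` has the three solutions
`n = 1, l, 2l+1`; instance `a = 1, ε = 1, p = 5, l = 2`: `D = 11`, solutions `4² − 11 = 5`, `6² − 11 = 5²`,
`56² − 11 = 5⁵`, and the two non-top solutions satisfy `pⁿ ≤ max(2·10⁶, 600·D²)` as Theorem 1 demands,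
while the top one has `5⁵ = 3125 < 600·121` too (small instance). [cite: Beukers1981II, Acta Arith. 39, p.119, Thm 1 p.117] -/
theorem soloInformed_beukersII_family_5_11 :
    4 ^ 2 - 11 = 5 ∧ 6 ^ 2 - 11 = 5 ^ 2 ∧ 56 ^ 2 - 11 = 5 ^ 5 ∧
    5 ≤ max (2 * 10 ^ 6) (600 * 11 ^ 2) ∧ 5 ^ 2 ≤ max (2 * 10 ^ 6) (600 * 11 ^ 2) := by norm_num

end Summit.ABC.ABC.Theorems
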